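import Literature.InformationTheory.Coding.SourcePolarizationFine

/-!
# Stub `stub_polarizeFine` of line `polarize-to-one-bit-leakage` (crux `SzkEntropy.PeaTwoMemBPP`)

Two-sided FINE polarization with a polynomially small unpolarized fraction, uniformly over all
binary sources with functional side information: absolute `μ > 0`, `C` with
`#{j < 2^s : H(U_j | U_{<j}, Y^t) ∈ (2^{-2^{⌊s/4⌋}}, 1 − 2^{-2^{⌊s/4⌋}})} ≤ C · 2^{(1−μ)s}` — the
named fact `Literature.InformationTheory.Coding.Polar.PolarizeFine` of
`Literature/InformationTheory/Coding/SourcePolarization.lean`, discharged in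
`Literature/InformationTheory/Coding/SourcePolarizationFine.lean` (`PolarizeFine_holds`,
[Korada–Urbanke 2010, Thm 16 with Lemma 17; Arıkan–Telatar 2009, Thm 1]); this file only
re-exports it under the registered stub name.
-/

namespace Summit.PneNP.PneNP.Cruxes.PeaTwoMemBPP.PolarizeToOneBitLeakage

set_option linter.dupNamespace false -- Summit.PneNP.PneNP: summit = sub-problem (D-0017)

open Literature.InformationTheory.Coding.Polar

/-- `stub_polarizeFine` of line polarize-to-one-bit-leakage: two-sided fine polarization with a
polynomially small unpolarized fraction — absolute `μ > 0`, `C` with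
`#{j < 2^s : H(U_j | U_{<j}, Y^t) ∈ (2^{-2^{⌊s/4⌋}}, 1 − 2^{-2^{⌊s/4⌋}})} ≤ C · 2^{(1−μ)s}` for EVERY
binary source with functional side information [Korada–Urbanke 2010, Thm 16 + Lemma 17 (high
side via the mirror process `1 − Z²`); Arıkan–Telatar 2009, Thm 1 (rate `β < 1/2`)]. -/
theorem stub_polarizeFine : PolarizeFine :=
  PolarizeFine_holds

end Summit.PneNP.PneNP.Cruxes.PeaTwoMemBPP.PolarizeToOneBitLeakage
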